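import Summits.AtomisticToContinuum.HydrodynamicLimit.Theorems.BoxDissipativeWeakStrongFluxClosureEntGaussExpMoment
import HarnessLib

/-!
# Crux `FluxClosure` (stmt-AtomisticToContinuum-9902, route BoxDissipativeWeakStrong), line `registered`:
# one-site exponential moment of the shifted-reference centred quadratic (sub-goal H1a1 of the entropy line for stub K)

Support file (`--supports stmt-AtomisticToContinuum-9902`) for the crux
`Summit.AtomisticToContinuum.HydrodynamicLimit.Theses.BoxDissipativeWeakStrong.FluxClosure`: the registered sub-goal
H1a1 `oneSite_lintegral_exp_shiftedQuad_le`. The entropy line for stub K needs the exponential moment of the box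
kinetic-stress integrand under local Gibbs laws; its one-site input is the moment generating function of the centred
velocity quadratic `(w_i - ū_i)(w_j - ū_j) - θ' δ_ij` taken at a SHIFTED reference `(ū, θ')` (the parameters of the box
centre) under the particle's own Maxwellian `N(u, θ𝟙) = gaussMeasure u θ`, with `‖u - ū‖ ≤ δu ≤ 1`, `|θ - θ'| ≤ δθ`,
`0 < θ ≤ θM`: for `|t| ≤ γ₀ := 1/(8 θM)`,
`∫ exp(t ((w_i - ū_i)(w_j - ū_j) - θ' δ_ij)) N(u, θ𝟙)(dw) ≤ exp(C t² + |t| (δθ + δu²))`, `C := 16 θM² + 8 θM`.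

Proof. With `d := u - ū` and `X := w - u ∼ N(0, θ𝟙)`,
`(w_i - ū_i)(w_j - ū_j) - θ' δ_ij = [X_i X_j - θ δ_ij] + [d_j X_i + d_i X_j] + [d_i d_j + (θ - θ') δ_ij]`.
The last bracket is deterministic of absolute value `≤ δu² + δθ` (`|d_k| ≤ ‖d‖`), giving the factor
`exp(|t| (δθ + δu²))`. For the random part, two pointwise AM–GM steps `2 e^{a+b} ≤ e^{2a} + e^{2b}` give
`4 exp(t [X_i X_j - θ δ_ij] + t [d_j X_i + d_i X_j]) ≤ 2 exp(2t [X_i X_j - θ δ_ij]) + exp(4 t d_j X_i) + exp(4 t d_i X_j)`,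
and the three Gaussian integrals are the landed one-site moments of
`BoxDissipativeWeakStrongFluxClosureEntGaussExpMoment` (`gauss_lintegral_exp_quad_le` (i): `≤ exp(4 θ² (2t)²)` for
`|2t| θ ≤ 1/4`; `entGa_lintegral_exp_lin_gaussMeasure`: `= exp(θ (4 t d_k)²/2) ≤ exp(8 θ t²)`), each `≤ exp(C t²)`.

No definitions, no new facts: the Ga file and Mathlib `lintegral` algebra only. References: standard (Gaussian moment
generating functions, e.g. A. Gut, *An Intermediate Course in Probability* (2009), Ch. III); H. Spohn, *Large Scale
Dynamics of Interacting Particles* (1991), Part I §2.3 (local Maxwellians).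
-/

noncomputable section

namespace Summit.AtomisticToContinuum.HydrodynamicLimit.Theorems
namespace FluxClosureEnt

open scoped BigOperators Topology Classical MeasureTheory ProbabilityTheory InnerProductSpace ENNReal
open Filter Set Function MeasureTheory ProbabilityTheory
open Literature.MathematicalPhysics.KineticTheory Literature.Analysis.FluidPDE

/-- A coordinate of a difference of vectors of `ℝ³` is bounded by its Euclidean norm: `|u_k - ū_k| ≤ ‖u - ū‖`.
[folklore] -/
theorem entSh_abs_sub_apply_le_norm (u ū : V3) (k : Fin 3) : |u k - ū k| ≤ ‖u - ū‖ := by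
  rw [← Real.norm_eq_abs, ← PiLp.sub_apply]
  exact PiLp.norm_apply_le (u - ū) k

/-- **H1a1: one-site exponential moment of the shifted-reference centred quadratic under a Gaussian.** For every
`θM > 0` there are `C ≥ 0` (`C := 16 θM² + 8 θM`) and `γ₀ > 0` (`γ₀ := 1/(8 θM)`) such that for `0 < θ ≤ θM`,
`0 ≤ δu ≤ 1`, `0 ≤ δθ`, `‖u - ū‖ ≤ δu`, `|θ - θ'| ≤ δθ`, all `i j` and `|t| ≤ γ₀`,
`∫ exp(t ((w_i - ū_i)(w_j - ū_j) - θ' δ_ij)) N(u, θ𝟙)(dw) ≤ exp(C t² + |t| (δθ + δu²))`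
(split off the deterministic shift, two AM–GM steps, and the one-site Gaussian moments of sub-goal Ga). [folklore] -/
theorem oneSite_lintegral_exp_shiftedQuad_le : ∀ θM : ℝ, 0 < θM → ∃ C : ℝ, 0 ≤ C ∧ ∃ γ₀ : ℝ, 0 < γ₀ ∧ ∀ (u ū : V3) (θ θ' δu δθ : ℝ), 0 < θ → θ ≤ θM → 0 ≤ δu → δu ≤ 1 → 0 ≤ δθ → ‖u - ū‖ ≤ δu → |θ - θ'| ≤ δθ → ∀ (i j : Fin 3) (t : ℝ), |t| ≤ γ₀ → ∫⁻ w, ENNReal.ofReal (Real.exp (t * ((w i - ū i) * (w j - ū j) - if i = j then θ' else 0))) ∂(gaussMeasure u θ) ≤ ENNReal.ofReal (Real.exp (C * t ^ 2 + |t| * (δθ + δu ^ 2))) := by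
  intro θM hθM
  refine ⟨16 * θM ^ 2 + 8 * θM, by positivity, 1 / (8 * θM), by positivity, ?_⟩
  intro u ū θ θ' δu δθ hθ hθle hδu hδu1 hδθ hU hT i j t ht
  set C : ℝ := 16 * θM ^ 2 + 8 * θM with hC
  set K : ℝ := |t| * (δθ + δu ^ 2) with hK
  have hC0 : 8 * θM ≤ C := by rw [hC]; nlinarith [sq_nonneg θM]
  -- (0) AM–GM for exponentials: `2 e^{a+b} ≤ e^{2a} + e^{2b}`
  have amgm : ∀ a b : ℝ, 2 * Real.exp (a + b) ≤ Real.exp (2 * a) + Real.exp (2 * b) := by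
    intro a b
    rw [Real.exp_add, show 2 * a = a + a by ring, show 2 * b = b + b by ring, Real.exp_add, Real.exp_add]
    nlinarith [sq_nonneg (Real.exp a - Real.exp b)]
  -- (1) the centred quadratic moment at `s = 2t` (sub-goal Ga (i)), `≤ exp(16 θ² t²) ≤ exp(C t²)`
  have h2t : |2 * t| * θ ≤ 1 / 4 := by
    rw [abs_mul, abs_two]
    have h1 : |t| * θ ≤ 1 / 8 :=
      calc |t| * θ ≤ 1 / (8 * θM) * θM := mul_le_mul ht hθle hθ.le (by positivity)
        _ = 1 / 8 := by field_simp
    linarith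
  have hI1 : ∫⁻ w, ENNReal.ofReal (Real.exp ((2 * t) * ((w i - u i) * (w j - u j) - if i = j then θ else 0)))
      ∂(gaussMeasure u θ) ≤ ENNReal.ofReal (Real.exp (C * t ^ 2)) := by
    refine (gauss_lintegral_exp_quad_le.1 u θ hθ i j (2 * t) h2t).trans
      (ENNReal.ofReal_le_ofReal (Real.exp_le_exp.2 ?_))
    have hθ2 : θ ^ 2 ≤ θM ^ 2 := pow_le_pow_left₀ hθ.le hθle 2
    have e1 := mul_le_mul_of_nonneg_right hθ2 (sq_nonneg t)
    have e2 := mul_nonneg hθM.le (sq_nonneg t)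
    rw [hC]
    nlinarith [e1, e2]
  -- (2) the linear moments at `s = 4 t d_k` (sub-goal Ga (ii)), `= exp(8 θ t² d_k²) ≤ exp(C t²)`
  have hI2 : ∀ (k : Fin 3) (c : ℝ), |c| ≤ δu →
      ∫⁻ w, ENNReal.ofReal (Real.exp ((4 * t * c) * (w k - u k))) ∂(gaussMeasure u θ) ≤
        ENNReal.ofReal (Real.exp (C * t ^ 2)) := by
    intro k c hc
    rw [entGa_lintegral_exp_lin_gaussMeasure u hθ k (4 * t * c)]
    refine ENNReal.ofReal_le_ofReal (Real.exp_le_exp.2 ?_)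
    have hc1 : |c| ≤ 1 := hc.trans hδu1
    have hc2 : c ^ 2 ≤ 1 := by
      rw [← sq_abs]
      nlinarith [abs_nonneg c]
    have h1 : θ * c ^ 2 ≤ θM := by nlinarith [sq_nonneg c]
    have e1 := mul_le_mul_of_nonneg_right h1 (sq_nonneg t)
    have e2 := mul_le_mul_of_nonneg_right hC0 (sq_nonneg t)
    nlinarith [e1, e2]
  -- (3) the deterministic remainder
  have hdi : |u i - ū i| ≤ δu := (entSh_abs_sub_apply_le_norm u ū i).trans hU
  have hdj : |u j - ū j| ≤ δu := (entSh_abs_sub_apply_le_norm u ū j).trans hU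
  have hR : t * ((u i - ū i) * (u j - ū j) + ((if i = j then θ else 0) - (if i = j then θ' else 0))) ≤ K := by
    have hprod : |(u i - ū i) * (u j - ū j)| ≤ δu ^ 2 := by
      rw [abs_mul, sq]
      exact mul_le_mul hdi hdj (abs_nonneg _) hδu
    have hite : |(if i = j then θ else 0) - (if i = j then θ' else 0)| ≤ δθ := by
      split_ifs
      · exact hT
      · simpa using hδθ
    have habs : |(u i - ū i) * (u j - ū j) + ((if i = j then θ else 0) - (if i = j then θ' else 0))| ≤
        δθ + δu ^ 2 :=
      (abs_add_le _ _).trans (by linarith)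
    calc t * ((u i - ū i) * (u j - ū j) + ((if i = j then θ else 0) - (if i = j then θ' else 0)))
        ≤ |t * ((u i - ū i) * (u j - ū j) + ((if i = j then θ else 0) - (if i = j then θ' else 0)))| :=
          le_abs_self _
      _ = |t| * |(u i - ū i) * (u j - ū j) + ((if i = j then θ else 0) - (if i = j then θ' else 0))| :=
          abs_mul _ _
      _ ≤ |t| * (δθ + δu ^ 2) := mul_le_mul_of_nonneg_left habs (abs_nonneg t)
  -- (4) the pointwise bound: split off the shift and two AM–GM steps
  have key : ∀ w : V3, 4 * Real.exp (t * ((w i - ū i) * (w j - ū j) - if i = j then θ' else 0)) ≤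
      Real.exp K * (2 * Real.exp ((2 * t) * ((w i - u i) * (w j - u j) - if i = j then θ else 0)) +
        Real.exp ((4 * t * (u j - ū j)) * (w i - u i)) + Real.exp ((4 * t * (u i - ū i)) * (w j - u j))) := by
    intro w
    have hQ : t * ((w i - ū i) * (w j - ū j) - if i = j then θ' else 0) =
        (t * ((w i - u i) * (w j - u j) - if i = j then θ else 0) +
          (t * (u j - ū j) * (w i - u i) + t * (u i - ū i) * (w j - u j))) +
        t * ((u i - ū i) * (u j - ū j) + ((if i = j then θ else 0) - (if i = j then θ' else 0))) := by
      split_ifs <;> ring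
    rw [hQ]
    set a : ℝ := t * ((w i - u i) * (w j - u j) - if i = j then θ else 0) with ha
    set p : ℝ := t * (u j - ū j) * (w i - u i) with hp
    set q : ℝ := t * (u i - ū i) * (w j - u j) with hq
    set r : ℝ := t * ((u i - ū i) * (u j - ū j) + ((if i = j then θ else 0) - (if i = j then θ' else 0)))
      with hr
    have e2 : (2 * t) * ((w i - u i) * (w j - u j) - if i = j then θ else 0) = 2 * a := by rw [ha]; ring
    have e3 : (4 * t * (u j - ū j)) * (w i - u i) = 2 * (2 * p) := by rw [hp]; ring
    have e4 : (4 * t * (u i - ū i)) * (w j - u j) = 2 * (2 * q) := by rw [hq]; ring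
    rw [e2, e3, e4, Real.exp_add (a + (p + q)) r]
    have h1 := amgm a (p + q)
    have h2 := amgm (2 * p) (2 * q)
    rw [mul_add] at h1
    have h3 : 4 * Real.exp (a + (p + q)) ≤
        2 * Real.exp (2 * a) + Real.exp (2 * (2 * p)) + Real.exp (2 * (2 * q)) := by linarith
    have hexpR : Real.exp r ≤ Real.exp K := Real.exp_le_exp.2 hR
    calc 4 * (Real.exp (a + (p + q)) * Real.exp r) = (4 * Real.exp (a + (p + q))) * Real.exp r := by ring
      _ ≤ (2 * Real.exp (2 * a) + Real.exp (2 * (2 * p)) + Real.exp (2 * (2 * q))) * Real.exp K :=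
          mul_le_mul h3 hexpR (Real.exp_pos _).le (by positivity)
      _ = _ := by ring
  -- (5) integrate
  have hmQ : Measurable fun w : V3 =>
      ENNReal.ofReal (Real.exp (t * ((w i - ū i) * (w j - ū j) - if i = j then θ' else 0))) := by
    fun_prop
  have hm1 : Measurable fun w : V3 =>
      ENNReal.ofReal (Real.exp ((2 * t) * ((w i - u i) * (w j - u j) - if i = j then θ else 0))) := by
    fun_prop
  have hm2 : Measurable fun w : V3 => ENNReal.ofReal (Real.exp ((4 * t * (u j - ū j)) * (w i - u i))) := by
    fun_prop
  have hm3 : Measurable fun w : V3 => ENNReal.ofReal (Real.exp ((4 * t * (u i - ū i)) * (w j - u j))) := by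
    fun_prop
  have hmS : Measurable fun w : V3 =>
      2 * ENNReal.ofReal (Real.exp ((2 * t) * ((w i - u i) * (w j - u j) - if i = j then θ else 0))) +
        ENNReal.ofReal (Real.exp ((4 * t * (u j - ū j)) * (w i - u i))) +
        ENNReal.ofReal (Real.exp ((4 * t * (u i - ū i)) * (w j - u j))) := by
    fun_prop
  have hI2i := hI2 i (u j - ū j) hdj
  have hI2j := hI2 j (u i - ū i) hdi
  have h4 : (4 : ℝ≥0∞) ≠ 0 := by norm_num
  have h4' : (4 : ℝ≥0∞) ≠ ∞ := ENNReal.ofNat_ne_top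
  refine (ENNReal.mul_le_mul_iff_right h4 h4').1 ?_
  rw [← lintegral_const_mul _ hmQ]
  calc ∫⁻ w, 4 * ENNReal.ofReal (Real.exp (t * ((w i - ū i) * (w j - ū j) - if i = j then θ' else 0)))
        ∂(gaussMeasure u θ)
      ≤ ∫⁻ w, ENNReal.ofReal (Real.exp K) *
          (2 * ENNReal.ofReal (Real.exp ((2 * t) * ((w i - u i) * (w j - u j) - if i = j then θ else 0))) +
            ENNReal.ofReal (Real.exp ((4 * t * (u j - ū j)) * (w i - u i))) +
            ENNReal.ofReal (Real.exp ((4 * t * (u i - ū i)) * (w j - u j)))) ∂(gaussMeasure u θ) := by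
        refine lintegral_mono fun w => ?_
        calc 4 * ENNReal.ofReal (Real.exp (t * ((w i - ū i) * (w j - ū j) - if i = j then θ' else 0)))
            = ENNReal.ofReal (4 * Real.exp (t * ((w i - ū i) * (w j - ū j) - if i = j then θ' else 0))) := by
              rw [ENNReal.ofReal_mul (by norm_num : (0 : ℝ) ≤ 4), ENNReal.ofReal_ofNat]
          _ ≤ ENNReal.ofReal (Real.exp K *
              (2 * Real.exp ((2 * t) * ((w i - u i) * (w j - u j) - if i = j then θ else 0)) +
                Real.exp ((4 * t * (u j - ū j)) * (w i - u i)) +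
                Real.exp ((4 * t * (u i - ū i)) * (w j - u j)))) := ENNReal.ofReal_le_ofReal (key w)
          _ = _ := by
              rw [ENNReal.ofReal_mul (Real.exp_pos _).le, ENNReal.ofReal_add (by positivity) (by positivity),
                ENNReal.ofReal_add (by positivity) (by positivity), ENNReal.ofReal_mul (by norm_num : (0 : ℝ) ≤ 2),
                ENNReal.ofReal_ofNat]
    _ = ENNReal.ofReal (Real.exp K) *
          (2 * ∫⁻ w, ENNReal.ofReal (Real.exp ((2 * t) * ((w i - u i) * (w j - u j) - if i = j then θ else 0)))
              ∂(gaussMeasure u θ) +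
            ∫⁻ w, ENNReal.ofReal (Real.exp ((4 * t * (u j - ū j)) * (w i - u i))) ∂(gaussMeasure u θ) +
            ∫⁻ w, ENNReal.ofReal (Real.exp ((4 * t * (u i - ū i)) * (w j - u j))) ∂(gaussMeasure u θ)) := by
        rw [lintegral_const_mul _ hmS, lintegral_add_right _ hm3, lintegral_add_right _ hm2,
          lintegral_const_mul _ hm1]
    _ ≤ ENNReal.ofReal (Real.exp K) * (2 * ENNReal.ofReal (Real.exp (C * t ^ 2)) +
          ENNReal.ofReal (Real.exp (C * t ^ 2)) + ENNReal.ofReal (Real.exp (C * t ^ 2))) := by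
        gcongr
    _ = 4 * ENNReal.ofReal (Real.exp (C * t ^ 2 + K)) := by
        rw [Real.exp_add, ENNReal.ofReal_mul (Real.exp_pos _).le]
        ring

end FluxClosureEnt
end Summit.AtomisticToContinuum.HydrodynamicLimit.Theorems

end
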